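/-
Origin: expansion seat `planner-pub-hodgecm-pv10-g3-0`, handover #3 2026-08-18T08:56:03Z (`HOME/pub-hodgecm-pv10-g3/lean/Pv10g3/HeightGalois.lean`, md5 62de664c, 101 lines);
landed by the gen-7 packager in gate run 27 as `HodgeCM/PerL34/HeightGalois.lean` (import ^import Pv10g3V\.→import HodgeCM.Vendored.H21. ×1).
-/
/-
Copyright (c) 2026. All rights reserved.
Released under Apache 2.0 license as described in the file LICENSE.
-/
import Literature.NumberTheory.Automorphic.AdelicVectorHeight
import Summits.HodgeConjecture.HodgeCM.PerL34.NormOneRelTorus_2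
import Mathlib.Algebra.FiniteSupport.Basic

/-!
# Galois invariance of the heights of adelic vectors

For a number field `L`, an automorphism `σ ∈ Aut(L/K)` acts on the adele ring `𝔸_L`
(vendored `Literature.NumberTheory.Automorphic.GaloisActionAdeleRing`: componentwise transport
`L_w → L_{σ w}`), hence coordinatewise on adelic vectors `x ∈ 𝔸_L^ι`.  The local heights of the
vendored height machinery (`AdelicVectorHeight`: `vecFinHeight`, `vecArchNorm`, `vecHeight`,
`IsHeightFinite`; Godement, Sém. Bourbaki 257 §1.1, Garrett (2018) §2.2) are PERMUTED by `σ`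
(`‖(σ • a)_{σ w}‖ = ‖a_w‖`: the package's `NumberField.norm_galAdicCompletionMap` at the finite places,
vendored `InfiniteAdeleRing.norm_smul_apply_smul` at the infinite ones), so the global height — a product
over all places — is INVARIANT: `h(σ • x) = h(x)`.  This is the vector version of the package's
`NumberField.ideleNorm_galSmul` (`PerL34/NormOneRelTorus`), proved by the same reindexing.

Main results (namespace `HodgeCM.PerL34.HeightGalois`, all kernel-checked, Mathlib + landed/vendored tree only):
* `vecFinHeight_galSmul`, `vecArchNorm_galSmul` — `h_v(σ • x) = h_{σ⁻¹ v}(x)`, `‖σ • x‖_w = ‖x‖_{σ⁻¹ w}`;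
* `isHeightFinite_galSmul_iff` — height-finiteness is invariant;
* `vecHeight_galSmul` — **`h(σ • x) = h(x)`**.
-/

set_option autoImplicit false

noncomputable section

open scoped NNReal

namespace HodgeCM.PerL34.HeightGalois

open NumberField IsDedekindDomain
open Literature.NumberTheory Literature.NumberTheory.Automorphic

variable {K L : Type} [Field K] [Field L] [NumberField L] [Algebra K L] {ι : Type*} [Fintype ι]

omit [Fintype ι] in
/-- Coordinates of `σ • x` (definitional). -/
theorem galSmul_apply (σ : L ≃ₐ[K] L) (x : ι → AdeleRing (𝓞 L) L) (i : ι) : (σ • x) i = σ • x i := rfl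

/-- **Finite local heights are permuted**: `h_v(σ • x) = h_{σ⁻¹ v}(x)`. -/
theorem vecFinHeight_galSmul (σ : L ≃ₐ[K] L) (v : HeightOneSpectrum (𝓞 L)) (x : ι → AdeleRing (𝓞 L) L) :
    vecFinHeight L v (σ • x) = vecFinHeight L (σ⁻¹ • v) x := by
  unfold vecFinHeight
  refine Finset.sup_congr rfl fun i _ => ?_
  apply NNReal.eq
  simp only [coe_nnnorm, galSmul_apply, AdeleRing.smul_snd, FiniteAdeleRing.smul_apply]
  exact NumberField.norm_galAdicCompletionMap σ _ _

/-- **Archimedean norms are permuted**: `‖σ • x‖_w = ‖x‖_{σ⁻¹ w}`. -/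
theorem vecArchNorm_galSmul (σ : L ≃ₐ[K] L) (w : InfinitePlace L) (x : ι → AdeleRing (𝓞 L) L) :
    vecArchNorm L w (σ • x) = vecArchNorm L (σ⁻¹ • w) x := by
  unfold vecArchNorm
  congr 1
  refine Finset.sum_congr rfl fun i _ => ?_
  congr 1
  apply NNReal.eq
  simp only [coe_nnnorm, galSmul_apply, AdeleRing.smul_fst, InfiniteAdeleRing.smul_apply]
  exact norm_galInfiniteCompletionMap K σ _ _

omit [NumberField L] in
/-- The multiplicity `mult w = [L_w : ℝ]` is `Aut(L/K)`-invariant. -/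
theorem mult_galSmul (σ : L ≃ₐ[K] L) (w : InfinitePlace L) : (σ • w).mult = w.mult := by
  unfold InfinitePlace.mult
  rw [InfinitePlace.isReal_smul_iff]

/-- Height-finiteness is `Aut(L/K)`-invariant. -/
theorem isHeightFinite_galSmul_iff (σ : L ≃ₐ[K] L) (x : ι → AdeleRing (𝓞 L) L) :
    IsHeightFinite L (σ • x) ↔ IsHeightFinite L x := by
  unfold IsHeightFinite
  have h : (fun v => vecFinHeight L v (σ • x)) = (fun v => vecFinHeight L v x) ∘ fun v => σ⁻¹ • v := by
    funext v; exact vecFinHeight_galSmul σ v x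
  rw [h]
  constructor
  · intro hf
    have h2 : (fun v => vecFinHeight L v x) =
        ((fun v => vecFinHeight L v x) ∘ fun v => σ⁻¹ • v) ∘ fun v => σ • v := by
      funext v; simp only [Function.comp_apply, inv_smul_smul]
    rw [h2]
    exact hf.comp_of_injective (MulAction.injective σ)
  · intro hf
    exact hf.comp_of_injective (MulAction.injective σ⁻¹)

/-- **Galois invariance of the height**: `h(σ • x) = h(x)` for `σ ∈ Aut(L/K)` and `x ∈ 𝔸_L^ι`. -/
theorem vecHeight_galSmul (σ : L ≃ₐ[K] L) (x : ι → AdeleRing (𝓞 L) L) :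
    vecHeight L (σ • x) = vecHeight L x := by
  unfold vecHeight
  congr 1
  · -- archimedean part: reindex along `w ↦ σ • w`
    refine (Fintype.prod_equiv (MulAction.toPerm σ) (fun w => vecArchNorm L w x ^ w.mult)
      (fun w => vecArchNorm L w (σ • x) ^ w.mult) fun w => ?_).symm
    rw [MulAction.toPerm_apply, vecArchNorm_galSmul, inv_smul_smul, mult_galSmul]
  · -- finite part: reindex along `v ↦ σ⁻¹ • v`
    simp_rw [vecFinHeight_galSmul σ _ x]
    exact finprod_eq_of_bijective (fun v => σ⁻¹ • v) (MulAction.bijective σ⁻¹) fun _ => rfl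

end HodgeCM.PerL34.HeightGalois
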